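import Literature.Topology.FourManifolds.FramedSpheresEvenFormLevel
import Literature.Topology.FourManifolds.SimplyConnectedBordismSurgery
import Literature.Topology.FourManifolds.HCobordismOddEnd
import Literature.Topology.FourManifolds.BallComplementFraming
import Literature.Topology.FourManifolds.CylinderCobordism
import Literature.Topology.FourManifolds.StabilisationCobordism
import Literature.Topology.FourManifolds.ThetaFourWall
import Literature.AlgebraicTopology.FundamentalGroup.SphereSimplyConnected
import HarnessLib

/-!
# The punctured cylinder `X × [0, 1] ∖ B⁵` over a 4-manifold all of whose sphere maps are stably
# framed: the level above the 2-handles is `S⁴ # k(S² × S²)`, with even intersection form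

Topic `Literature/Topology/FourManifolds`.  Prove-seat of Wall's theorem
`Literature.Topology.FourManifolds.isHCobordant_of_equivalent_intersectionForm` (Wall 1964,
Thm. 2); second file (after `FramedSpheresEvenFormLevel.lean`) of the proof of its parity step
C4 — Kirby 1989, Ch. II §4 with Lemma 4.1: *for a simply connected closed smooth 4-manifold
all of whose sphere maps are stably tangent-framed, the intersection form is even* — along the
following route, which uses no characteristic classes: let `W' = X × [0, 1] ∖ B⁵` be the
cylinder with an open ball removed from its interior, a simply connected cobordism from the new
boundary sphere `S⁴` to `X ⊔ X`; its interior is an open piece of the interior of the cylinder,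
so every sphere map into it is stably framed (for the cylinder this is the contrapositive of the
tree's `Cobordism.IsHCobordism.exists_not_hasStableTangentFramingAlong_left`); hence
(`Cobordism.exists_middleLevel_isStabilization_left_of_isEven_interior`) the level `M_{1/2}`
above the 2-handles of a nice Morse function is `S⁴ # k(S² × S²)`, whose intersection form
`kH` is even.  (The remaining, homological, half of C4 — Thom's isotropy theorem on the upper
slab `M_{1/2} → X ⊔ X` — is the sequel.)

* `hasStableTangentFramingAlong_interior_cylinder` — sphere maps into the interior of the
  cylinder over `X` are stably framed if those into `X` are;
* `BallRemovalData.isInteriorPoint_toAmbient`, `BallRemovalData.hasStableTangentFramingAlong_interior_K`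
  — the interior of `K = W ∖ i(B̊)` maps into the interior of `W` by a smooth equidimensional
  immersion (`BallComplementFraming.lean`), along which stable framings pull back;
* `isEven_intersectionForm_of_isStabilization_sphereFour` — a stabilisation of `S⁴` has even
  intersection form (`exists_stabilisationCobordism`: `Q ≅ Q_{S⁴} ⊥ kH = kH`);
* `puncturedCylinder`, `simplyConnectedSpace_cylinderNull_W`,
  `exists_level_puncturedCylinder_isEven` — **the punctured cylinder read from `S⁴` is simply
  connected with stably framed interior, and carries a nice Morse function with all critical
  points of index `≥ 2` whose level `g⁻¹(1/2)` is a closed smooth 4-manifold with EVEN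
  intersection form for every orientation.**

Everything is proved; the only definition is the abbreviation `puncturedCylinder`; no named fact.

## References

* R. C. Kirby, *The topology of 4-manifolds*, LNM 1374 (1989), Ch. II §4 and Lemma 4.1 (p. 23
  of the held scan), Ch. X p. 55. [Kirby1989]
* J. Milnor, *Lectures on the h-cobordism theorem* (1965), Thm. 3.4, 4.8, 8.1. [MilnorHCobordism1965]
* M. Kervaire, J. Milnor, *Groups of homotopy spheres I*, Ann. of Math. 77 (1963), Lemma 2.3
  (proof, p. 506). [KervaireMilnorAnnals1963]
-/

open scoped Manifold ContDiff Topology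
open Set Function Metric
open Literature.AlgebraicTopology.SingularHomology

noncomputable section

namespace Literature.Topology.FourManifolds

/-- Local notation: `𝔼 n` is the model Euclidean space `EuclideanSpace ℝ (Fin n)`. -/
local notation "𝔼 " n:arg => EuclideanSpace ℝ (Fin n)

/-- Local notation: `𝕊 n` is the unit sphere in `EuclideanSpace ℝ (Fin (n + 1))`. -/
local notation "𝕊 " n:arg => (Metric.sphere (0 : EuclideanSpace ℝ (Fin (n + 1))) 1)

/-- Local notation: the unit `2`-sphere. -/
local notation "𝕊²" => (Metric.sphere (0 : EuclideanSpace ℝ (Fin (2 + 1))) 1)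

/-- Local notation: `Q⟦μ⟧` is the intersection form on `H²(−; ℤ)/T`. -/
local notation "Q⟦" μ "⟧" =>
  Literature.AlgebraicTopology.SingularHomology.intersectionForm two_add_two_eq_four μ

section Cylinder

variable {X : Type} [TopologicalSpace X] [T2Space X] [SecondCountableTopology X]
  [ChartedSpace (𝔼 4) X] [IsManifold (𝓡 4) ∞ X] [CompactSpace X]

/-- **If every sphere map into a closed 4-manifold `X` is stably tangent-framed, so is every
sphere map into the interior of the cylinder `X × [0, 1]`** — contrapositive of the tree's
`Cobordism.IsHCobordism.exists_not_hasStableTangentFramingAlong_left` for the trivial h-cobordism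
(every sphere map into the interior is homotopic to one in a level, Milnor Thm. 3.4).
[cite: Kirby1989, Ch. X p. 56] [cite: MilnorHCobordism1965, Thm. 3.4, Cor. 3.5] -/
theorem hasStableTangentFramingAlong_interior_cylinder [SimplyConnectedSpace X]
    (hX : ∀ h : C(𝕊², X), HasStableTangentFramingAlong (𝓡 4) X h)
    (T : C(𝕊², Cobordism.PassageSetting.Wb (cylinderCobordism 4 X))) :
    HasStableTangentFramingAlong (𝓡 (4 + 1)) (Cobordism.PassageSetting.Wb (cylinderCobordism 4 X)) T := by
  by_contra hT
  obtain ⟨h, hh⟩ := Cobordism.IsHCobordism.exists_not_hasStableTangentFramingAlong_left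
    (cylinderCobordism 4 X) (cylinderCobordism_isHCobordism 4 X) ⟨T, hT⟩
  exact hh (hX h)

end Cylinder

section BallRemoval

variable {W : Type} [TopologicalSpace W] [T2Space W]
  [ChartedSpace (EuclideanHalfSpace (4 + 1)) W] [IsManifold (𝓡∂ (4 + 1)) ∞ W]
  (D : BallRemovalData 4 W)

/-- The map `K → W` (`a ↦ a`, `b ↦ i(b/‖b‖²)`) sends interior points to interior points.
[cite: KervaireMilnorAnnals1963, Lemma 2.3, proof (p. 506)] -/
theorem BallRemovalData.isInteriorPoint_toAmbient (k : D.K) (hk : (𝓡∂ (4 + 1)).IsInteriorPoint k) :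
    (𝓡∂ (4 + 1)).IsInteriorPoint (D.glueData.lift Subtype.val D.glueInvPt D.val_eq_glueInvPt_glue k) := by
  rcases D.glueData.exists_inl_or_inr k with ⟨a, rfl⟩ | ⟨b, rfl⟩
  · show (𝓡∂ (4 + 1)).IsInteriorPoint (a : W)
    by_contra hb
    have hb' : (𝓡∂ (4 + 1)).IsBoundaryPoint (a : W) :=
      ((𝓡∂ (4 + 1)).isBoundaryPoint_iff_not_isInteriorPoint _).2 hb
    have := (D.isBoundaryPoint_inl_iff a).2 hb'
    exact ((𝓡∂ (4 + 1)).isBoundaryPoint_iff_not_isInteriorPoint _).1 this hk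
  · show (𝓡∂ (4 + 1)).IsInteriorPoint (D.glueInvPt b)
    exact D.isInteriorPoint_i _

/-- **The interior of `K = W ∖ i(B̊)` maps into the interior of `W` by a smooth equidimensional
immersion**, so every sphere map into the interior of `K` along which `TW♭ ⊕ ℝ` (pulled back) is
framed has `TK♭ ⊕ ℝ` framed along it. [cite: Hirsch1976, Ch. 4 §1–§2] -/
theorem BallRemovalData.hasStableTangentFramingAlong_interior_K
    (hW : ∀ T : C(𝕊², InteriorManifold (𝓡∂ (4 + 1)) W),
      HasStableTangentFramingAlong (𝓡 (4 + 1)) (InteriorManifold (𝓡∂ (4 + 1)) W) T)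
    (T : C(𝕊², InteriorManifold (𝓡∂ (4 + 1)) D.K)) :
    HasStableTangentFramingAlong (𝓡 (4 + 1)) (InteriorManifold (𝓡∂ (4 + 1)) D.K) T := by
  set j : D.K → W := D.glueData.lift Subtype.val D.glueInvPt D.val_eq_glueInvPt_glue with hj
  -- the lift of `j` to the interiors
  let ψ : InteriorManifold (𝓡∂ (4 + 1)) D.K → InteriorManifold (𝓡∂ (4 + 1)) W :=
    fun x => ⟨j x.val, D.isInteriorPoint_toAmbient x.val x.isInteriorPoint⟩
  have hψs : ContMDiff (𝓡 (4 + 1)) (𝓡 (4 + 1)) 1 ψ := by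
    refine (InteriorManifold.contMDiff_iff_comp_val.2 ?_)
    exact (InteriorManifold.contMDiff_comp_val (D.contMDiff_toAmbient)).of_le (by exact_mod_cast le_top)
  have hψinv : ∀ p, (mfderiv (𝓡 (4 + 1)) (𝓡 (4 + 1)) ψ (T p)).IsInvertible := by
    intro p
    have hn : (1 : WithTop ℕ∞) ≠ 0 := by simp
    have h1 : mfderiv (𝓡 (4 + 1)) (𝓡 (4 + 1)) ψ (T p) =
        mfderiv (𝓡 (4 + 1)) (𝓡∂ (4 + 1)) (InteriorManifold.val ∘ ψ) (T p) :=
      (InteriorManifold.mfderiv_comp_val ((hψs (T p)).mdifferentiableAt hn)).symm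
    have h2 : InteriorManifold.val ∘ ψ = j ∘ (InteriorManifold.val : InteriorManifold (𝓡∂ (4 + 1)) D.K → D.K) := rfl
    rw [h1, h2, mfderiv_comp (T p) ((D.contMDiff_toAmbient _).mdifferentiableAt (by simp))
      (InteriorManifold.mdifferentiableAt_val _), InteriorManifold.mfderiv_val]
    exact (D.isInvertible_mfderiv_toAmbient (T p).val).comp
      ⟨ContinuousLinearEquiv.refl ℝ (𝔼 (4 + 1)), rfl⟩
  have hψc : Continuous ψ := hψs.continuous
  exact HasStableTangentFramingAlong.of_comp_of_isInvertible_mfderiv T.continuous hψs hψinv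
    (hW ((⟨ψ, hψc⟩ : C(InteriorManifold (𝓡∂ (4 + 1)) D.K, InteriorManifold (𝓡∂ (4 + 1)) W)).comp T))

end BallRemoval

section SphereFour

attribute [local instance] fact_finrank_euclideanSpace_succ in
/-- **A stabilisation of the 4-sphere has an even intersection form**: if `P = S⁴ # k(S² × S²)`
(`IsStabilization k S⁴ P`) then `Q_P ≅ Q_{S⁴} ⊥ kH = kH` (the lattice data of the stabilisation
cobordism, `exists_stabilisationCobordism`; `H²(S⁴; ℤ)/T = 0`) and the hyperbolic plane is even.
[cite: Kirby1989, Ch. X, proof of Thm. 1, p. 55] -/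
theorem isEven_intersectionForm_of_isStabilization_sphereFour {k : ℕ} {P : Type}
    [TopologicalSpace P] [T2Space P] [ChartedSpace (𝔼 4) P] [IsManifold (𝓡 4) ∞ P]
    (hP : IsStabilization k (𝕊 4) P) (μP : HomologicalOrientation ℤ P 4) :
    (Q⟦μP⟧).IsEven := by
  haveI : SimplyConnectedSpace (𝕊 4) :=
    Literature.AlgebraicTopology.FundamentalGroup.simplyConnectedSpace_euclideanSphere 4 (by norm_num)
  obtain ⟨μS⟩ := isOrientableOver_of_simplyConnectedSpace ℤ (𝕊 4) (n := 4)
  obtain ⟨-, -, -, hdata⟩ := exists_stabilisationCobordism k (𝕊 4) P hP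
  obtain ⟨-, -, Θ, -, μX', -, -, -, -, -, -, -, hform⟩ := hdata μS μP
  intro x
  obtain ⟨y, rfl⟩ := Θ.surjective x
  rw [hform]
  have h1 : Q⟦μX'⟧ y.1 y.1 = 0 := by
    have hy : y.1 = 0 := Subsingleton.elim (h := subsingleton_freeCohomology_two_sphere_four) _ _
    rw [hy, map_zero]
  rw [h1, zero_add]
  exact Finset.even_sum _ fun j _ => isEven_hyperbolicForm (y.2 j)

end SphereFour

section PuncturedCylinder

variable {X : Type} [TopologicalSpace X] [T2Space X] [SecondCountableTopology X]
  [ChartedSpace (𝔼 4) X] [IsManifold (𝓡 4) ∞ X] [CompactSpace X] [SimplyConnectedSpace X]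

/-- The cylinder over a simply connected closed 4-manifold is simply connected. [folklore] -/
theorem simplyConnectedSpace_cylinderNull_W : SimplyConnectedSpace (cylinderNull 3 X).W := by
  obtain ⟨e, -⟩ := (cylinderCobordism_isHCobordism 4 X).1
  exact e.symm.simplyConnectedSpace

/-- **The punctured cylinder** `X × [0, 1] ∖ B⁵` read as a cobordism from the new boundary
sphere `S⁴` to `X ⊔ X` (`BallRemovalData.cobordism` of the cylinder `cylinderNull`, reversed).
[cite: KervaireMilnorAnnals1963, Lemma 2.3, proof (p. 506)] -/
def puncturedCylinder (D : BallRemovalData 4 (cylinderNull 3 X).W) : Cobordism 4 (𝕊 4) (X ⊕ X) :=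
  (D.cobordism (cylinderNull 3 X)).symm

omit [SimplyConnectedSpace X] in
/-- The total space of the punctured cylinder is `K` (definitional). [folklore] -/
theorem puncturedCylinder_W (D : BallRemovalData 4 (cylinderNull 3 X).W) :
    (puncturedCylinder D).W = D.K := rfl

/-- **The level above the 2-handles of the punctured cylinder.**  Let `X` be a simply connected
closed smooth 4-manifold all of whose sphere maps are stably tangent-framed, and
`W' = X × [0, 1] ∖ B⁵` the cylinder with an open ball removed from its interior, read as a
cobordism from the new boundary sphere `S⁴` to `X ⊔ X`.  Then `W'` is simply connected, its
interior is stably framed along every sphere map, and it carries a nice Morse function with all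
critical points of index `≥ 2` whose level `g⁻¹(1/2)` is presented by a closed smooth 4-manifold
`N = S⁴ # k(S² × S²)` whose intersection form is even for every orientation.
[cite: Kirby1989, Ch. X p. 55] [cite: MilnorHCobordism1965, Thm. 4.8, Thm. 8.1] -/
theorem exists_level_puncturedCylinder_isEven
    (hX : ∀ h : C(𝕊², X), HasStableTangentFramingAlong (𝓡 4) X h) :
    ∃ (D : BallRemovalData 4 (cylinderNull 3 X).W)
      (g : (puncturedCylinder D).W → ℝ)
      (N : Type) (_ : TopologicalSpace N) (_ : T2Space N) (_ : SecondCountableTopology N)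
      (_ : ChartedSpace (EuclideanSpace ℝ (Fin 4)) N) (_ : CompactSpace N) (_ : IsManifold (𝓡 4) ∞ N)
      (e : N → (puncturedCylinder D).W),
      SimplyConnectedSpace (puncturedCylinder D).W ∧
      (puncturedCylinder D).IsNiceMorseFunction g ∧
      (∀ z, IsMCriticalPt (𝓡∂ (4 + 1)) g z → 2 ≤ morseIndex (𝓡∂ (4 + 1)) g z) ∧
      Manifold.IsSmoothEmbedding (𝓡 4) (𝓡∂ (4 + 1)) ∞ e ∧ range e = g ⁻¹' {2⁻¹} ∧
      ∀ μN : HomologicalOrientation ℤ N 4, (Q⟦μN⟧).IsEven := by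
  haveI : SimplyConnectedSpace (cylinderNull 3 X).W := simplyConnectedSpace_cylinderNull_W
  haveI : SimplyConnectedSpace (𝕊 4) :=
    Literature.AlgebraicTopology.FundamentalGroup.simplyConnectedSpace_euclideanSphere 4 (by norm_num)
  obtain ⟨D⟩ := (cylinderNull 3 X).nonempty_ballRemovalData
  have hsc : SimplyConnectedSpace (puncturedCylinder D).W :=
    (cylinderNull 3 X).simplyConnectedSpace_ballRemoval_cobordism D
  have heven : ∀ T : C(𝕊², Cobordism.PassageSetting.Wb (puncturedCylinder D)),
      HasStableTangentFramingAlong (𝓡 (4 + 1)) (Cobordism.PassageSetting.Wb (puncturedCylinder D)) T :=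
    fun T => D.hasStableTangentFramingAlong_interior_K
      (fun T' => hasStableTangentFramingAlong_interior_cylinder hX T') T
  obtain ⟨g, N, i₁, i₂, i₃, i₄, i₅, i₆, e, hg, h2, he, her, hst⟩ :=
    (puncturedCylinder D).exists_middleLevel_isStabilization_left_of_isEven_interior hsc heven
  refine ⟨D, g, N, i₁, i₂, i₃, i₄, i₅, i₆, e, hsc, hg, h2, he, her, fun μN => ?_⟩
  exact isEven_intersectionForm_of_isStabilization_sphereFour hst μN

end PuncturedCylinder

end Literature.Topology.FourManifolds

end
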